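/-
HONEST FRAMING: certified error envelopes and provably optimal rounding/accumulation schemes for
low-precision formats under stated cost models; every table by two implementations; no hardware
or vendor claims.
-/
import Summits.Ventures.CertifiedArithmetic.LowPrec.OptDemotionRoutingConjD
import Summits.Ventures.CertifiedArithmetic.LowPrec.OptDemotionRoutingVal
import Summits.Ventures.CertifiedArithmetic.LowPrec.OptDemotionRoutingShift

/-!
# The demotion law (Theorem T8), part 8k: Conjecture D from the LOCAL ROUTING LEMMA (opt gen 13, R19/R20)

The node step of the routing conjecture.  opt's LOCAL ROUTING LEMMA `LRL(a, b)` (gen13/README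
R19): at a node with children `a, b` computing a `q`-bit budget `m ∈ [2^(q-1), 2^q)`, no pair of
child configurations `(A, B)` that a nearest-rounding addition can produce — `q`-bit floats
`val A, val B ≤ m` with `val A + val B ≤ m + ½` (half an ulp of `m`) — beats the best BIT
PARTITION of `bits(m) ∪ {the half-ulp bit}`:  `2^(q-1) + BR_a(A) + BR_b(B) ≤ BR_(a·b)(bits m)`.
THIS FILE: `LRL q` (all pairs of subtrees, all budgets) implies `RoutingBound q s` for EVERY shape
(`routingBound_of_LRL`: induction over the budget relaxation `Φ*`'s node rule of part 7a′ — every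
admissible candidate pair `(a, bmax)` is such a pair `(A, B)` after reading the children's routing
values at the parent's scale, part 8j), hence CONJECTURE D FOR EVERY TREE (`conjectureD_of_LRL`,
with part 8e).  What opt's reduction theorem (R20) adds: `LRL` follows from the two-tree inequality
(TT) by the un-carry descent, using monotonicity (M, part 8i) and midpoint convexity (MC, part 8h).
-/

namespace Summit.Ventures.CertifiedArithmetic.LowPrec.Opt

open Literature.ComputerArithmetic.JeannerodRump2018
open Literature.ComputerArithmetic.JeannerodRump2018.SumTree

/-- opt's LOCAL ROUTING LEMMA as a hypothesis on the precision `q` (all pairs of subtrees, all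
budgets): for `m ∈ [2^(q-1), 2^q)` and routable `A, B` with `val A, val B ≤ m`,
`val A + val B ≤ m + ½`:  `2^(q-1) + BR_a(A) + BR_b(B) ≤ BR_(a·b)(bits m)`.  (Equivalent, given
`BR ≤ W`, to the node step of the routing conjecture `W = BR`; reduced by opt R20 to (TT).) -/
def LRL (q : ℕ) : Prop :=
  ∀ (a b : SumTree) (m : ℕ), 2 ^ (q - 1) ≤ m → m < 2 ^ q →
    ∀ (A B : Finset ℤ), Routable q A → Routable q B →
      val A ≤ m → val B ≤ m → val A + val B ≤ m + 1 / 2 →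
        (2 : ℚ) ^ ((q : ℤ) - 1) + treeBR q a A + treeBR q b B ≤ treeBR q (.node a b) (natBits m)

/-- The value of a translate. -/
theorem val_image_add (k : ℤ) (S : Finset ℤ) : val (S.image fun e => e + k) = (2 : ℚ) ^ k * val S := by
  unfold val
  rw [Finset.sum_image fun x _ y _ h => add_injective k h, Finset.mul_sum]
  exact Finset.sum_congr rfl fun e _ => by rw [zpow_add₀ (by norm_num)]; ring

/-- `val (natBits m) = m`. -/
theorem val_natBits (m : ℕ) : val (natBits m) = m := sum_natBits m

/-- `u · 2^(q-1) = ½` (`q ≥ 1`). -/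
theorem unitRoundoff_mul_half_pow (q : ℕ) :
    unitRoundoff q * (2 : ℚ) ^ ((q : ℤ) - 1) = 1 / 2 := by
  unfold unitRoundoff
  rw [zpow_sub₀ (by norm_num), zpow_natCast, zpow_one]
  have : (2 : ℚ) ^ q ≠ 0 := by positivity
  field_simp

/-- **THE ROUTING CONJECTURE FROM THE LOCAL ROUTING LEMMA**: `LRL q` implies `RoutingBound q s`
for every shape `s` (`q ≥ 1`). -/
theorem routingBound_of_LRL {q : ℕ} (hq : 1 ≤ q) (hL : LRL q) : ∀ s : Shape, RoutingBound q s
  | .lf => by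
      intro m hm hm'
      rw [phi_lf hm hm' hq]
      have := mul_nonneg (unitRoundoff_nonneg q) (treeBR_nonneg q (Shape.lf.toTree) (natBits m))
      linarith
  | .nd a b => by
      intro m hm hm'
      have iha := routingBound_of_LRL hq hL a
      have ihb := routingBound_of_LRL hq hL b
      set u := unitRoundoff q with hu
      have hu0 : 0 ≤ u := unitRoundoff_nonneg q
      have huH := unitRoundoff_mul_half_pow q
      rw [← hu] at huH
      have hmR : Routable q (natBits m) := natBits_routable hm'
      rw [phi_nd hm hm' hq]
      show nodeEntry q (phiTab q a) (phiTab q b) m ≤ (m : ℚ) + u * treeBR q (Shape.nd a b).toTree (natBits m)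
      have htree : (Shape.nd a b).toTree = .node a.toTree b.toTree := rfl
      rw [htree]
      unfold nodeEntry
      refine candMax_le q _ _ m ?_ (cands q) fun c hc hok => ?_
      · -- the `a = 0` term: Φ*_b(m) ≤ m + u BR_b(bits m) ≤ m + u BR_(a·b)(bits m)
        rw [gval_phiTab]
        unfold phiVal
        rw [pow_zero, div_one]
        have h1 := ihb m hm hm'
        rw [← hu] at h1
        have h2 := hL a.toTree b.toTree m hm hm' ∅ (natBits m) (routable_empty q) hmR
          (by rw [val_empty]; exact Nat.cast_nonneg m) (by rw [val_natBits])
          (by rw [val_empty, val_natBits]; linarith)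
        have h0 : treeBR q a.toTree ∅ = 0 := by rw [treeBR, treeBRw_empty]
        rw [h0] at h2
        have h4 := mul_le_mul_of_nonneg_left h2 hu0
        rw [mul_add, mul_add, mul_zero] at h4
        change phi q b m ≤ (m : ℚ) + u * treeBR q (.node a.toTree b.toTree) (natBits m)
        change phi q b m ≤ (m : ℚ) + u * treeBR q b.toTree (natBits m) at h1
        linarith
      · -- an admissible candidate (ma, ja) with its partner bmax
        obtain ⟨hma, hma', hja⟩ := cands_bounds hq hc
        have hα : (c.1 : ℚ) / 2 ^ c.2 ≤ m := (candOK_iff_rat hja).1 hok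
        obtain ⟨hmb, hmb', hβ, hsum, -⟩ := bmax_spec hq hm hm' hma' hja hα
        set mb := (bmax q m (c.1 * 2 ^ (q + 1 - c.2))).1 with hmbdef
        set jb := (bmax q m (c.1 * 2 ^ (q + 1 - c.2))).2 with hjbdef
        unfold candTerm
        rw [gval_phiTab, gval_phiTab, ← hmbdef, ← hjbdef]
        unfold phiVal
        have h1 := iha c.1 hma hma'
        have h2 := ihb mb hmb hmb'
        change phi q a c.1 ≤ (c.1 : ℚ) + unitRoundoff q * treeBR q a.toTree (natBits c.1) at h1
        change phi q b mb ≤ (mb : ℚ) + unitRoundoff q * treeBR q b.toTree (natBits mb) at h2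
        rw [← hu] at h1 h2
        -- the children's configurations read at the parent's scale
        set A := (natBits c.1).image fun e => e + (-(c.2 : ℤ)) with hA
        set B := (natBits mb).image fun e => e + (-(jb : ℤ)) with hB
        have hAval : val A = (c.1 : ℚ) / 2 ^ c.2 := by
          rw [hA, val_image_add, val_natBits, zpow_neg, zpow_natCast]; field_simp
        have hBval : val B = (mb : ℚ) / 2 ^ jb := by
          rw [hB, val_image_add, val_natBits, zpow_neg, zpow_natCast]; field_simp
        have hABR : treeBR q a.toTree A = treeBR q a.toTree (natBits c.1) / 2 ^ c.2 := by
          rw [treeBR, treeBR, hA, treeBRw_zpow_shift, zpow_neg, zpow_natCast]; field_simp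
        have hBBR : treeBR q b.toTree B = treeBR q b.toTree (natBits mb) / 2 ^ jb := by
          rw [treeBR, treeBR, hB, treeBRw_zpow_shift, zpow_neg, zpow_natCast]; field_simp
        have hL' := hL a.toTree b.toTree m hm hm' A B
          ((routable_image_add_iff _ _).2 (natBits_routable hma'))
          ((routable_image_add_iff _ _).2 (natBits_routable hmb'))
          (by rw [hAval]; exact hα) (by rw [hBval]; exact hβ) (by rw [hAval, hBval]; linarith)
        rw [hABR, hBBR] at hL'
        -- Φ*_a(α) + Φ*_b(β) ≤ α + β + u (BR_a(A) + BR_b(B)) ≤ m + ½ + u (BR_(a·b) - 2^(q-1))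
        have hja0 : (0 : ℚ) < 2 ^ c.2 := by positivity
        have hjb0 : (0 : ℚ) < 2 ^ jb := by positivity
        have e1 : phi q a c.1 / 2 ^ c.2 ≤ (c.1 : ℚ) / 2 ^ c.2 + u * (treeBR q a.toTree (natBits c.1) / 2 ^ c.2) := by
          rw [mul_div_assoc', ← add_div]; exact div_le_div_of_nonneg_right h1 hja0.le
        have e2 : phi q b mb / 2 ^ jb ≤ (mb : ℚ) / 2 ^ jb + u * (treeBR q b.toTree (natBits mb) / 2 ^ jb) := by
          rw [mul_div_assoc', ← add_div]; exact div_le_div_of_nonneg_right h2 hjb0.le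
        have e3 := mul_le_mul_of_nonneg_left hL' hu0
        rw [mul_add, mul_add] at e3
        change phi q a c.1 / 2 ^ c.2 + phi q b mb / 2 ^ jb ≤
          (m : ℚ) + u * treeBR q (.node a.toTree b.toTree) (natBits m)
        linarith

/-- **CONJECTURE D FOR EVERY TREE FROM THE LOCAL ROUTING LEMMA**: `LRL q` implies
`s ≤ Q_t · fl_p(ŝ)` for every summation tree of nonnegative `F(q, emin)` data, every `p ≥ 1`, any
nearest roundings (parts 8e + this file). -/
theorem conjectureD_of_LRL {q p : ℕ} (hp : 1 ≤ p) (hq : 1 ≤ q) (hL : LRL q) {emin : ℤ}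
    {fl flp : ℚ → ℚ} (hfl : IsRoundNearest q emin fl) (hflp : IsRoundNearest p emin flp)
    (t : SumTree) (ht : ∀ x ∈ leaves t, IsFloat q emin x ∧ 0 ≤ x) :
    exact t ≤ treeQf (unitRoundoff q) t (unitRoundoff p) * flp (eval fl t) :=
  conjectureD_of_routingBound hp hq hfl hflp t ht (routingBound_of_LRL hq hL (shapeOf t))

end Summit.Ventures.CertifiedArithmetic.LowPrec.Opt
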